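import Summits.QuantumFields.YangMills.Theorems.BalabanUVNodesK2NamedJetsRemAt

/-!
# CRIT-2 g2 — ROUND 2c probe (idea-7 `corner-limit-sign` EDITION 2, located-B junction J2)

Edition 2's supplier road (R-k) `cornerSign_of_namedAnchor` wants a `CornerAnchor (fun k => cβ * b0 k) γ β` to θ-covariant NAMED numbers.
v4's line-1′ stub 2′ `RemAtSomeJets` (DEF-1 ed.3 letter `RemAt F κ θ hP θ.cβ`, tree p593586) CARRIES `ScaleAnchor βfun (fun k => θ.cβ * beta0OfJs F κ k)`.
This probe proves the junction: `ScaleAnchor` (DEF-1, over `B12Beta.HistBox`) and `CornerAnchor` (idea-7 :70 verbatim, over `FlowStep.Box`) are the SAME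
hypothesis (the two boxes are the same set; the `δ ≤ γ` clause is free), and `RemAt F κ θ hP c → CornerAnchor (c·beta0OfJs F κ) θ.γ (datum).βfun`.
So a v5 corner line can be typed on v4's OWN letter: {`U3TripleAtRecord13G` (K3-shared), `RemAtSomeJets` (v4 :209, shared with line 1′),
eventual sign of the named numbers that shadow a record} — no `OneLoopDrift`, no v₀-ray, no definitional split. [folklore]
-/

namespace Summit.QuantumFields.YangMills.Cruxes.EndpointGivenBR13SepCoPH.Crit2Round2c

open Literature.MathematicalPhysics.QuantumFieldTheory.Balaban1983to89
open Literature.MathematicalPhysics.QuantumFieldTheory.Balaban1983to89.FlowStep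
open Literature.MathematicalPhysics.QuantumFieldTheory.Balaban1983to89.T4Continuum (T4Family)
open Literature.MathematicalPhysics.QuantumFieldTheory.Balaban1983to89.B12Beta (HistBox)
open Summit.QuantumFields.YangMills.Theorems.BalabanUVNodesK2JsOfRecord (StepColourData beta0OfJs)
open Summit.QuantumFields.YangMills.Theorems.BalabanUVNodesK2NamedJetsRemAt (ScaleAnchor RemAt)

/-- verbatim from `CornerLimitSignSketch.lean` :70 (idea-7). -/
def CornerAnchor (b : ℕ → ℝ) (γ : ℝ) (β : HBeta) : Prop :=
  ∀ k : ℕ, ∀ ε : ℝ, 0 < ε → ∃ δ : ℝ, 0 < δ ∧ δ ≤ γ ∧ ∀ v ∈ Box δ k, |β k v - b k| ≤ ε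

/-- The two boxes are the same set. [folklore] -/
theorem histBox_eq_box (γ : ℝ) (k : ℕ) : HistBox γ k = Box γ k := by
  ext v; simp [HistBox, mem_box]

/-- Boxes are monotone in the window. [folklore] -/
theorem box_mono {δ δ' : ℝ} (h : δ ≤ δ') (k : ℕ) : Box δ k ⊆ Box δ' k := by
  intro v hv
  rw [mem_box] at hv ⊢
  exact fun i => ⟨(hv i).1, (hv i).2.trans h⟩

/-- J2 (⇒): DEF-1's per-scale anchor gives idea-7's corner anchor on every positive window. [folklore] -/
theorem cornerAnchor_of_scaleAnchor {β : HBeta} {b : ℕ → ℝ} {γ : ℝ} (hγ : 0 < γ) (h : ScaleAnchor β b) : CornerAnchor b γ β := by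
  intro k ε hε
  obtain ⟨γ', hγ', hA⟩ := h k ε hε
  refine ⟨min γ' γ, lt_min hγ' hγ, min_le_right _ _, fun v hv => hA v ?_⟩
  rw [histBox_eq_box]
  exact box_mono (min_le_left _ _) k hv

/-- J2 (⇐): the corner anchor gives DEF-1's per-scale anchor. [folklore] -/
theorem scaleAnchor_of_cornerAnchor {β : HBeta} {b : ℕ → ℝ} {γ : ℝ} (h : CornerAnchor b γ β) : ScaleAnchor β b := by
  intro k δ hδ
  obtain ⟨δ', hδ', -, hA⟩ := h k δ hδ
  exact ⟨δ', hδ', fun p hp => hA p (by rw [← histBox_eq_box]; exact hp)⟩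

/-- RECORD LEVEL: v4's letter `RemAt F κ θ hP c` (stub 2′ produces `∃ κ` with `c = θ.cβ`) supplies road (R-k)'s corner anchor to the θ-covariant named
numbers `k ↦ c * beta0OfJs F κ k` on the record's own window `θ.γ`. [folklore] -/
theorem cornerAnchor_of_remAt {F : T4Family} {κ : StepColourData} {θ : Node00.Stage13HParams F 2} {hP : θ.Provisos₁₃SepCoPH F 2} {c : ℝ}
    (h : RemAt F κ θ hP c) : CornerAnchor (fun k => c * beta0OfJs F κ k) θ.γ (Node00.datumOfRecord₁₃SepCoPH F 2 θ hP).βfun := by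
  obtain ⟨γ₀, _s, hγ₀, hγ₀le, _hs, _hrem, hanch, _hcont⟩ := h
  exact cornerAnchor_of_scaleAnchor (lt_of_lt_of_le hγ₀ hγ₀le) hanch

end Summit.QuantumFields.YangMills.Cruxes.EndpointGivenBR13SepCoPH.Crit2Round2c
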